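import Literature.Computability.AlgebraicComplexity.GlobalStageStructure
import HarnessLib

/-!
# The structure of a hashed stage in abstract form: after the compatibility and usefulness zero-outs
the tensor is a direct sum, over the present block triples, of broken copies of the useful sub-tensors
(Vassilevska Williams–Xu–Xu–Zhou 2024, §5.3–§5.5 and §6.3–§6.5: "The proof of this claim is the same
as (cl:global:compatible)", "𝒯''' = ⊕ 𝒯'''|_{X_I Y_J Z_K}") — proved

Topic `Literature/Computability/AlgebraicComplexity`.  The global stage (§5) and the constituent stage
(§6) of Vassilevska Williams–Xu–Xu–Zhou, *New bounds for matrix multiplication: from alpha to omega*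
(SODA 2024, arXiv:2307.07970) share their deterministic skeleton: hash the block triples of a universe
`𝒯` (asymmetric cleanup, `GlobalStagePresent.presentTriples`), then zero out the level-1 `X`/`Y`-blocks
not USEFUL for the unique present triple of their block (compatibility zero-out I), the level-1
`Z`-blocks COMPATIBLE with more than one present triple (zero-out II) and those not useful for their
triple (usefulness zero-out); the result is level-1-independent and splits as a direct sum over the
present triples of copies of the useful sub-tensor `𝒯*` with holes (Claims 5.9–5.11, resp. 6.10 and
§6.4–§6.5, whose proofs "are the same").  The tree's `GlobalStageStructure.lean` does this for the §5
data (`GlobalStageData`: classes `S_{i,j,k}` over all positions, ambient tensor the full power).  This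
file PROVES it once in ABSTRACT form, for

* an arbitrary universe `𝒯` of block triples on `N` chunk positions with `𝒯α ⊆ 𝒯` and a set of
  buckets `B` (`HashedZeroOut`),
* arbitrary usefulness predicates `UX, UY, UZ` and a compatibility predicate `CZ` (triple, level-1
  sequence), and
* an AMBIENT zero-out of the power given by sets `AX, AY, AZ` of admitted level-1 sequences (§6: the
  level-1 blocks of the input `ε`-interface tensor, whose complement inside `𝒯*` are the holes of the
  first type; §5: everything),

under the hypotheses `WellFormed`: `𝒯α ⊆ 𝒯`; `𝒯` is closed under recombining the three blocks of
its triples into a level triple; usefulness implies compatibility on `𝒯α`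
(`IsUsefulFor.isCompatibleWith`); and the combinatorial core of **Claim 5.9 / 6.10**: for complementary
level-1 sequences `Î + Ĵ + K̂ = 2⃗` with `Î, Ĵ` useful for the triple `T₀` of their blocks and `K̂` useful
for some triple of `𝒯α` through `Z_K`, `K̂` is compatible with `T₀`.  Results:

* `respectsAssignment` — **level-1-independence** of the zeroed-out tensor (`finalTensor`);
* `finalTensor_restrictsTo_directSum` / `directSum_restrictsTo_finalTensor` — it is the direct sum
  of its summands over the present triples (`IndependentBlocks.lean`);
* `summand_eq_brokenCopy` — **the summand over a present `T` is the useful sub-tensor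
  `usefulSub T` restricted to the ambient blocks, with the second-type holes `holes T` (useful
  `Z`-blocks compatible with another present triple through `Z_K`) removed**: a broken copy of `𝒯*_T`
  whose holes are `AXᶜ, AYᶜ` (first type) and `AZᶜ ∪ holes T` (first and second type).

Everything is proved; the definitions are the zero-out predicates, the assignment, `usefulSub` and
`summand`; no named facts.

## References

* V. Vassilevska Williams, Y. Xu, Z. Xu, R. Zhou, *New bounds for matrix multiplication: from alpha
  to omega*, SODA 2024, arXiv:2307.07970 (held: `paper:arxiv-2307.07970`): §5.3–§5.5 (Claims 5.9,
  5.11, the direct sum), §6.3–§6.5 (Def. 6.9, Claim 6.10, zero-out II, Def. 6.11, `𝒯*`, the two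
  types of holes). [VassilevskaWilliamsXuXuZhou2024]
-/

noncomputable section

open scoped BigOperators
open Finset

namespace Literature.Computability.AlgebraicComplexity

open Literature.Barriers.MatrixMultiplication (bigCwTensor)

universe u

/-- **The data of a hashed stage**: the universe `𝒯` of block triples (on `N` chunk positions, block
indices `≤ 2c`), the distinguished triples `𝒯α` (consistent with `α`, resp. `{α_t}`), the buckets `B`,
the usefulness predicates for the three dimensions, the compatibility predicate for `Z`, and the
ambient sets of admitted level-1 sequences. [cite: VassilevskaWilliamsXuXuZhou2024, §5.2–§5.5 and §6.2–§6.5] -/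
structure HashedZeroOut (c N M : ℕ) where
  /-- the universe of block triples -/
  𝒯 : Finset ((Fin N → Fin (2 * c + 1)) × (Fin N → Fin (2 * c + 1)) × (Fin N → Fin (2 * c + 1)))
  /-- the distinguished triples (consistent with `α`) -/
  𝒯α : Finset ((Fin N → Fin (2 * c + 1)) × (Fin N → Fin (2 * c + 1)) × (Fin N → Fin (2 * c + 1)))
  /-- the buckets (a Salem–Spencer set) -/
  B : Finset (ZMod M)
  /-- usefulness of a level-1 `X`-sequence for a triple -/
  UX : (Fin N → Fin (2 * c + 1)) × (Fin N → Fin (2 * c + 1)) × (Fin N → Fin (2 * c + 1)) → (Fin N → Fin c → Fin 3) → Prop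
  /-- usefulness of a level-1 `Y`-sequence for a triple -/
  UY : (Fin N → Fin (2 * c + 1)) × (Fin N → Fin (2 * c + 1)) × (Fin N → Fin (2 * c + 1)) → (Fin N → Fin c → Fin 3) → Prop
  /-- usefulness of a level-1 `Z`-sequence for a triple -/
  UZ : (Fin N → Fin (2 * c + 1)) × (Fin N → Fin (2 * c + 1)) × (Fin N → Fin (2 * c + 1)) → (Fin N → Fin c → Fin 3) → Prop
  /-- compatibility of a level-1 `Z`-sequence with a triple -/
  CZ : (Fin N → Fin (2 * c + 1)) × (Fin N → Fin (2 * c + 1)) × (Fin N → Fin (2 * c + 1)) → (Fin N → Fin c → Fin 3) → Prop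
  /-- admitted level-1 `X`-sequences of the ambient zero-out -/
  AX : Finset (Fin N → Fin c → Fin 3)
  /-- admitted level-1 `Y`-sequences of the ambient zero-out -/
  AY : Finset (Fin N → Fin c → Fin 3)
  /-- admitted level-1 `Z`-sequences of the ambient zero-out -/
  AZ : Finset (Fin N → Fin c → Fin 3)

namespace HashedZeroOut

open scoped Classical

variable {c N M : ℕ} (S : HashedZeroOut c N M)

/-- The present triples after hashing with seed `ω` and cleanup. [cite: VassilevskaWilliamsXuXuZhou2024, §5.2 and §6.2 (𝒯')] -/
abbrev present (ω : VxxzSeed M N) :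
    Finset ((Fin N → Fin (2 * c + 1)) × (Fin N → Fin (2 * c + 1)) × (Fin N → Fin (2 * c + 1))) :=
  presentTriples (2 * c) S.𝒯 S.𝒯α ω S.B

/-! ### The kept level-1 blocks -/

/-- **`X_Î` is kept**: admitted, and its block lies in a present triple for which `Î` is useful
(compatibility zero-out I for `X`). [cite: VassilevskaWilliamsXuXuZhou2024, §5.3 and §6.3 ("zero out X_Î if split(Î, S_{t,i',j',k'}) ≠ β_{X,t,i',j',k'}")] -/
def keepX (ω : VxxzSeed M N) (Ih : Fin N → Fin c → Fin 3) : Prop :=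
  Ih ∈ S.AX ∧ ∃ T ∈ S.present ω, T.1 = blockOfSeq Ih ∧ S.UX T Ih

/-- **`Y_Ĵ` is kept.** [cite: VassilevskaWilliamsXuXuZhou2024, §5.3 and §6.3] -/
def keepY (ω : VxxzSeed M N) (Jh : Fin N → Fin c → Fin 3) : Prop :=
  Jh ∈ S.AY ∧ ∃ T ∈ S.present ω, T.2.1 = blockOfSeq Jh ∧ S.UY T Jh

/-- **`Z_K̂` is kept**: admitted, and there is a present triple through `Z_K` for which `K̂` is useful and
which is the only present triple through `Z_K` compatible with `K̂` (zero-outs I–II and the usefulness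
zero-out). [cite: VassilevskaWilliamsXuXuZhou2024, §5.3–§5.5 and §6.3–§6.5] -/
def keepZ (ω : VxxzSeed M N) (Kh : Fin N → Fin c → Fin 3) : Prop :=
  Kh ∈ S.AZ ∧ ∃ T ∈ S.present ω, T.2.2 = blockOfSeq Kh ∧ S.UZ T Kh ∧
    ∀ T' ∈ S.present ω, T'.2.2 = blockOfSeq Kh → S.CZ T' Kh → T' = T

/-- **The holes of the second type of the copy over the present triple `T`**: useful `Z`-sequences
compatible with another present triple through `Z_K`. [cite: VassilevskaWilliamsXuXuZhou2024, §5.4 / Claim 5.11 and §6.4 ("they become holes")] -/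
def holes (ω : VxxzSeed M N) (T : (Fin N → Fin (2 * c + 1)) × (Fin N → Fin (2 * c + 1)) × (Fin N → Fin (2 * c + 1))) :
    Finset (Fin N → Fin c → Fin 3) :=
  univ.filter fun Kh => blockOfSeq Kh = T.2.2 ∧ S.UZ T Kh ∧
    ∃ T' ∈ S.present ω, T' ≠ T ∧ T'.2.2 = T.2.2 ∧ S.CZ T' Kh

variable (R : Type u) [CommSemiring R] (q : ℕ)

/-- **The final tensor**: the zero-out of `(CW_q^{⊗c})^{⊗N}` keeping the kept level-1 blocks.
[cite: VassilevskaWilliamsXuXuZhou2024, §5.5 and §6.5 ("We call the current tensor 𝒯'''")] -/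
def finalTensor (ω : VxxzSeed M N) :
    (Fin N → Fin c → Fin (q + 2)) → (Fin N → Fin c → Fin (q + 2)) → (Fin N → Fin c → Fin (q + 2)) → R :=
  partSubtensor levelSeq levelSeq levelSeq (kroneckerPow (kroneckerPow (bigCwTensor R q) c) N)
    (univ.filter (S.keepX ω)) (univ.filter (S.keepY ω)) (univ.filter (S.keepZ ω))

/-- **The useful sub-tensor `𝒯*_T`** over the triple `T`: the zero-out of the power keeping the level-1
blocks inside the blocks of `T` that are useful for `T`. [cite: VassilevskaWilliamsXuXuZhou2024, Claim 5.11 and §6.5 (𝒯*)] -/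
def usefulSub (T : (Fin N → Fin (2 * c + 1)) × (Fin N → Fin (2 * c + 1)) × (Fin N → Fin (2 * c + 1))) :
    (Fin N → Fin c → Fin (q + 2)) → (Fin N → Fin c → Fin (q + 2)) → (Fin N → Fin c → Fin (q + 2)) → R :=
  partSubtensor levelSeq levelSeq levelSeq (kroneckerPow (kroneckerPow (bigCwTensor R q) c) N)
    (univ.filter fun Ih => blockOfSeq Ih = T.1 ∧ S.UX T Ih) (univ.filter fun Jh => blockOfSeq Jh = T.2.1 ∧ S.UY T Jh)
    (univ.filter fun Kh => blockOfSeq Kh = T.2.2 ∧ S.UZ T Kh)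

/-! ### The assignment of the kept level-1 blocks to present triples -/

/-- The present triple of a kept `X`-sequence (`none` if not kept). [cite: VassilevskaWilliamsXuXuZhou2024, §5.5 (level-1-independence)] -/
def assignX (ω : VxxzSeed M N) (Ih : Fin N → Fin c → Fin 3) : Option ↥(S.present ω) :=
  if h : S.keepX ω Ih then some ⟨h.2.choose, h.2.choose_spec.1⟩ else none

/-- The present triple of a kept `Y`-sequence. [cite: VassilevskaWilliamsXuXuZhou2024, §5.5] -/
def assignY (ω : VxxzSeed M N) (Jh : Fin N → Fin c → Fin 3) : Option ↥(S.present ω) :=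
  if h : S.keepY ω Jh then some ⟨h.2.choose, h.2.choose_spec.1⟩ else none

/-- The present triple of a kept `Z`-sequence. [cite: VassilevskaWilliamsXuXuZhou2024, §5.5] -/
def assignZ (ω : VxxzSeed M N) (Kh : Fin N → Fin c → Fin 3) : Option ↥(S.present ω) :=
  if h : S.keepZ ω Kh then some ⟨h.2.choose, h.2.choose_spec.1⟩ else none

variable {S R q}

/-- `assignX Î = T` iff `Î` is admitted, lies in `X_{T.1}` and is useful for `T`. [cite: VassilevskaWilliamsXuXuZhou2024, §5.5] -/
theorem assignX_eq_some_iff {ω : VxxzSeed M N} {Ih : Fin N → Fin c → Fin 3} {T : ↥(S.present ω)} :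
    S.assignX ω Ih = some T ↔ Ih ∈ S.AX ∧ T.1.1 = blockOfSeq Ih ∧ S.UX T.1 Ih := by
  unfold assignX
  split_ifs with h
  · have hc := h.2.choose_spec
    constructor
    · intro he
      have he' := Subtype.ext_iff.1 (Option.some_injective _ he)
      simp only at he'
      rw [← he']
      exact ⟨h.1, hc.2.1, hc.2.2⟩
    · rintro ⟨-, h1, hu⟩
      congr 1
      apply Subtype.ext
      exact presentTriples_eq_of_fst_eq hc.1 T.2 (hc.2.1.trans h1.symm)
  · constructor
    · intro he; exact absurd he (by simp)
    · rintro ⟨hA, h1, hu⟩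
      exact absurd ⟨hA, T.1, T.2, h1, hu⟩ h

/-- `assignY Ĵ = T` iff `Ĵ` is admitted, lies in `Y_{T.2.1}` and is useful for `T`. [cite: VassilevskaWilliamsXuXuZhou2024, §5.5] -/
theorem assignY_eq_some_iff {ω : VxxzSeed M N} {Jh : Fin N → Fin c → Fin 3} {T : ↥(S.present ω)} :
    S.assignY ω Jh = some T ↔ Jh ∈ S.AY ∧ T.1.2.1 = blockOfSeq Jh ∧ S.UY T.1 Jh := by
  unfold assignY
  split_ifs with h
  · have hc := h.2.choose_spec
    constructor
    · intro he
      have he' := Subtype.ext_iff.1 (Option.some_injective _ he)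
      simp only at he'
      rw [← he']
      exact ⟨h.1, hc.2.1, hc.2.2⟩
    · rintro ⟨-, h1, hu⟩
      congr 1
      apply Subtype.ext
      exact presentTriples_eq_of_snd_eq hc.1 T.2 (hc.2.1.trans h1.symm)
  · constructor
    · intro he; exact absurd he (by simp)
    · rintro ⟨hA, h1, hu⟩
      exact absurd ⟨hA, T.1, T.2, h1, hu⟩ h

variable (S) in
/-- **The standing hypotheses**: `𝒯α ⊆ 𝒯`; `𝒯` contains every level triple assembled from the blocks of
three of its members; on `𝒯α` usefulness implies compatibility; and the combinatorial core of
**Claim 5.9 / 6.10**: for complementary level-1 sequences (`Î + Ĵ + K̂ = 2⃗`) with `Î`, `Ĵ` useful for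
the triple `T₀ ∈ 𝒯α` of their blocks and `K̂` useful for some `T₃ ∈ 𝒯α` through `Z_K`, `K̂` is compatible
with `T₀`. [cite: VassilevskaWilliamsXuXuZhou2024, Claim 5.9 / Claim 6.10 and Def. 5.10–5.12 / Def. 6.9–6.11] -/
structure WellFormed : Prop where
  /-- the distinguished triples lie in the universe -/
  subset : S.𝒯α ⊆ S.𝒯
  /-- the universe is closed under recombination of blocks into level triples -/
  closed : ∀ T₁ ∈ S.𝒯, ∀ T₂ ∈ S.𝒯, ∀ T₃ ∈ S.𝒯,
    ∀ T₀ : (Fin N → Fin (2 * c + 1)) × (Fin N → Fin (2 * c + 1)) × (Fin N → Fin (2 * c + 1)),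
      T₀.1 = T₁.1 → T₀.2.1 = T₂.2.1 → T₀.2.2 = T₃.2.2 →
        (∀ p, seqVal T₀.1 p + seqVal T₀.2.1 p + seqVal T₀.2.2 p = 2 * c) → T₀ ∈ S.𝒯
  /-- useful `Z`-sequences are compatible -/
  usefulCompatible : ∀ T ∈ S.𝒯α, ∀ Kh, S.UZ T Kh → S.CZ T Kh
  /-- Claim 5.9 / 6.10 -/
  claim59 : ∀ Ih Jh Kh : Fin N → Fin c → Fin 3, (∀ u p, (Ih u p : ℕ) + Jh u p + Kh u p = 2) →
    (blockOfSeq Ih, blockOfSeq Jh, blockOfSeq Kh) ∈ S.𝒯α →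
      S.UX (blockOfSeq Ih, blockOfSeq Jh, blockOfSeq Kh) Ih → S.UY (blockOfSeq Ih, blockOfSeq Jh, blockOfSeq Kh) Jh →
        ∀ T₃ ∈ S.𝒯α, T₃.2.2 = blockOfSeq Kh → S.UZ T₃ Kh → S.CZ (blockOfSeq Ih, blockOfSeq Jh, blockOfSeq Kh) Kh

/-- `assignZ K̂ = T` iff `K̂` is admitted, lies in `Z_{T.2.2}`, is useful for `T`, and `T` is the only
present triple through `Z_K` compatible with `K̂`. [cite: VassilevskaWilliamsXuXuZhou2024, §5.4–§5.5 and §6.4–§6.5] -/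
theorem assignZ_eq_some_iff (hS : S.WellFormed) {ω : VxxzSeed M N} {Kh : Fin N → Fin c → Fin 3} {T : ↥(S.present ω)} :
    S.assignZ ω Kh = some T ↔ Kh ∈ S.AZ ∧ T.1.2.2 = blockOfSeq Kh ∧ S.UZ T.1 Kh ∧
      ∀ T' ∈ S.present ω, T'.2.2 = blockOfSeq Kh → S.CZ T' Kh → T' = T.1 := by
  unfold assignZ
  split_ifs with h
  · have hc := h.2.choose_spec
    constructor
    · intro he
      have he' := Subtype.ext_iff.1 (Option.some_injective _ he)
      simp only at he'
      rw [← he']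
      exact ⟨h.1, hc.2.1, hc.2.2.1, hc.2.2.2⟩
    · rintro ⟨-, h1, hu, huniq⟩
      have hcompat : S.CZ h.2.choose Kh := hS.usefulCompatible _ (presentTriples_subset hc.1) _ hc.2.2.1
      have heq : h.2.choose = T.1 := huniq _ hc.1 hc.2.1 hcompat
      congr 1
      exact Subtype.ext heq
  · constructor
    · intro he; exact absurd he (by simp)
    · rintro ⟨hA, h1, hu, huniq⟩
      exact absurd ⟨hA, T.1, T.2, h1, hu, huniq⟩ h

/-! ### Level-1-independence -/

/-- **Level-1-independence of the final tensor**: every non-zero entry of the power all three of whose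
level-1 blocks are kept has them assigned to ONE present triple — the `X`- and `Y`-blocks by the
uniqueness of present triples through a kept block, the `Z`-block by Claim 5.9 / 6.10 and the
uniqueness recorded in `keepZ`. [cite: VassilevskaWilliamsXuXuZhou2024, §5.5 and §6.5 (level-1-independence), Claims 5.9 / 6.10] -/
theorem respectsAssignment (hS : S.WellFormed) (R : Type u) [CommSemiring R] (q : ℕ) (ω : VxxzSeed M N) :
    RespectsAssignment levelSeq levelSeq levelSeq (kroneckerPow (kroneckerPow (bigCwTensor R q) c) N)
      (S.assignX ω) (S.assignY ω) (S.assignZ ω) := by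
  intro x y z T₁ T₂ T₃ hne h1 h2 h3
  rw [assignX_eq_some_iff] at h1
  rw [assignY_eq_some_iff] at h2
  rw [assignZ_eq_some_iff hS] at h3
  obtain ⟨-, hI, huX⟩ := h1
  obtain ⟨-, hJ, huY⟩ := h2
  obtain ⟨-, hK, huZ, huniq⟩ := h3
  -- the block triple `T₀` of the entry lies in `𝒯` and is hash-present
  set T₀ : (Fin N → Fin (2 * c + 1)) × (Fin N → Fin (2 * c + 1)) × (Fin N → Fin (2 * c + 1)) :=
    (blockOfSeq (levelSeq x), blockOfSeq (levelSeq y), blockOfSeq (levelSeq z)) with hT₀def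
  obtain ⟨hT₁𝒯, hT₁x, -, -⟩ := mem_presentTriples.1 T₁.2
  obtain ⟨hT₂𝒯, -, hT₂y, -⟩ := mem_presentTriples.1 T₂.2
  obtain ⟨hT₃𝒯, -, -, hT₃z⟩ := mem_presentTriples.1 T₃.2
  have hlev := isLevelTriple_of_ne_zero R q hne
  have hT₀ : T₀ ∈ S.𝒯 := by
    refine hS.closed _ hT₁𝒯 _ hT₂𝒯 _ hT₃𝒯 T₀ hI.symm hJ.symm hK.symm fun p => ?_
    have := hlev p
    simpa [hT₀def, chunkLevels_eq_seqVal_blockOfSeq] using this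
  rw [hI] at hT₁x
  rw [hJ] at hT₂y
  rw [hK] at hT₃z
  have hT₀p : T₀ ∈ hashPresent (2 * c) S.𝒯 ω S.B :=
    mem_hashPresent.2 ⟨hT₀, (mem_keptX.1 hT₁x).2.1, (mem_keptY.1 hT₂y).2.1, (mem_keptZ.1 hT₃z).2⟩
  -- `T₁ = T₀ = T₂`
  have e₁ : T₁.1 = T₀ := hashPresent_unique_of_mem_keptX hT₁x (hashPresent_of_mem_presentTriples T₁.2) hT₀p hI rfl
  have e₂ : T₂.1 = T₀ := hashPresent_unique_of_mem_keptY hT₂y (hashPresent_of_mem_presentTriples T₂.2) hT₀p hJ rfl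
  have h12 : T₁ = T₂ := Subtype.ext (e₁.trans e₂.symm)
  -- `T₃ = T₀` by Claim 5.9 / 6.10
  have hT₀α : T₀ ∈ S.𝒯α := e₁ ▸ presentTriples_subset T₁.2
  have huX' : S.UX T₀ (levelSeq x) := by rw [← e₁]; exact huX
  have huY' : S.UY T₀ (levelSeq y) := by rw [← e₂]; exact huY
  have hcompat : S.CZ T₀ (levelSeq z) :=
    hS.claim59 (levelSeq x) (levelSeq y) (levelSeq z) (levelSeq_add_of_ne_zero R q hne) hT₀α huX' huY'
      T₃.1 (presentTriples_subset T₃.2) hK huZ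
  have e₃ : T₀ = T₃.1 := huniq _ (e₁ ▸ T₁.2) rfl hcompat
  exact ⟨h12, Subtype.ext (e₂.trans e₃)⟩

/-! ### The final tensor is the direct sum of its summands -/

/-- The kept parts of the assignment are the kept blocks (`X`). [folklore] -/
theorem keptParts_assignX (ω : VxxzSeed M N) : keptParts (S.assignX ω) = univ.filter (S.keepX ω) := by
  ext Ih
  rw [mem_keptParts, mem_filter]
  simp only [mem_univ, true_and, assignX]
  split_ifs with h <;> simp [h]

/-- The kept parts of the assignment are the kept blocks (`Y`). [folklore] -/
theorem keptParts_assignY (ω : VxxzSeed M N) : keptParts (S.assignY ω) = univ.filter (S.keepY ω) := by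
  ext Jh
  rw [mem_keptParts, mem_filter]
  simp only [mem_univ, true_and, assignY]
  split_ifs with h <;> simp [h]

/-- The kept parts of the assignment are the kept blocks (`Z`). [folklore] -/
theorem keptParts_assignZ (ω : VxxzSeed M N) : keptParts (S.assignZ ω) = univ.filter (S.keepZ ω) := by
  ext Kh
  rw [mem_keptParts, mem_filter]
  simp only [mem_univ, true_and, assignZ]
  split_ifs with h <;> simp [h]

variable (S R q) in
/-- **The summand of the final tensor over the present triple `T`.** [cite: VassilevskaWilliamsXuXuZhou2024, §5.5 and §6.5 (the subtensor over X_I Y_J Z_K)] -/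
def summand (ω : VxxzSeed M N) (T : ↥(S.present ω)) :
    (Fin N → Fin c → Fin (q + 2)) → (Fin N → Fin c → Fin (q + 2)) → (Fin N → Fin c → Fin (q + 2)) → R :=
  partSubtensor levelSeq levelSeq levelSeq (kroneckerPow (kroneckerPow (bigCwTensor R q) c) N)
    (assignedParts (S.assignX ω) T) (assignedParts (S.assignY ω) T) (assignedParts (S.assignZ ω) T)

/-- The final tensor as the kept tensor of the assignment. [folklore] -/
theorem finalTensor_eq (R : Type u) [CommSemiring R] (q : ℕ) (ω : VxxzSeed M N) :
    S.finalTensor R q ω = partSubtensor levelSeq levelSeq levelSeq (kroneckerPow (kroneckerPow (bigCwTensor R q) c) N)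
      (keptParts (S.assignX ω)) (keptParts (S.assignY ω)) (keptParts (S.assignZ ω)) := by
  rw [keptParts_assignX, keptParts_assignY, keptParts_assignZ, finalTensor]

/-- **`final ≥ ⊕_{T present} (summand T)`.** [cite: VassilevskaWilliamsXuXuZhou2024, §5.5 and §6.5] -/
theorem finalTensor_restrictsTo_directSum (hS : S.WellFormed) (R : Type u) [CommSemiring R] (q : ℕ) (ω : VxxzSeed M N) :
    TensorRestrictsTo (S.finalTensor R q ω) (familyDirectSum fun T : ↥(S.present ω) => S.summand R q ω T) := by
  rw [finalTensor_eq]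
  exact partSubtensor_kept_restrictsTo_familyDirectSum _ (respectsAssignment hS R q ω)

/-- **`⊕_{T present} (summand T) ≥ final`.** [cite: VassilevskaWilliamsXuXuZhou2024, §5.5 and §6.5] -/
theorem directSum_restrictsTo_finalTensor (hS : S.WellFormed) (R : Type u) [CommSemiring R] (q : ℕ) (ω : VxxzSeed M N) :
    TensorRestrictsTo (familyDirectSum fun T : ↥(S.present ω) => S.summand R q ω T) (S.finalTensor R q ω) := by
  rw [finalTensor_eq]
  exact familyDirectSum_restrictsTo_partSubtensor_kept _ (respectsAssignment hS R q ω)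

/-! ### Each summand is a broken copy of the useful sub-tensor -/

/-- The `X`-parts assigned to `T`: admitted, in `X_I`, useful. [cite: VassilevskaWilliamsXuXuZhou2024, Claim 5.11 (proof) and §6.5] -/
theorem assignedParts_assignX {ω : VxxzSeed M N} (T : ↥(S.present ω)) :
    assignedParts (S.assignX ω) T = (univ.filter fun Ih => blockOfSeq Ih = T.1.1 ∧ S.UX T.1 Ih) ∩ S.AX := by
  ext Ih
  rw [mem_assignedParts, assignX_eq_some_iff, mem_inter, mem_filter]
  simp only [mem_univ, true_and]
  exact ⟨fun h => ⟨⟨h.2.1.symm, h.2.2⟩, h.1⟩, fun h => ⟨h.2, h.1.1.symm, h.1.2⟩⟩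

/-- The `Y`-parts assigned to `T`. [cite: VassilevskaWilliamsXuXuZhou2024, Claim 5.11 (proof) and §6.5] -/
theorem assignedParts_assignY {ω : VxxzSeed M N} (T : ↥(S.present ω)) :
    assignedParts (S.assignY ω) T = (univ.filter fun Jh => blockOfSeq Jh = T.1.2.1 ∧ S.UY T.1 Jh) ∩ S.AY := by
  ext Jh
  rw [mem_assignedParts, assignY_eq_some_iff, mem_inter, mem_filter]
  simp only [mem_univ, true_and]
  exact ⟨fun h => ⟨⟨h.2.1.symm, h.2.2⟩, h.1⟩, fun h => ⟨h.2, h.1.1.symm, h.1.2⟩⟩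

/-- The `Z`-parts assigned to `T`: admitted, useful and NOT a second-type hole. [cite: VassilevskaWilliamsXuXuZhou2024, Claim 5.11 and §6.5] -/
theorem assignedParts_assignZ (hS : S.WellFormed) {ω : VxxzSeed M N} (T : ↥(S.present ω)) :
    assignedParts (S.assignZ ω) T =
      (univ.filter fun Kh => blockOfSeq Kh = T.1.2.2 ∧ S.UZ T.1 Kh) ∩ (S.AZ \ S.holes ω T.1) := by
  ext Kh
  rw [mem_assignedParts, assignZ_eq_some_iff hS, mem_inter, mem_sdiff, mem_filter, holes, mem_filter]
  simp only [mem_univ, true_and]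
  constructor
  · rintro ⟨hA, h1, hu, huniq⟩
    refine ⟨⟨h1.symm, hu⟩, hA, ?_⟩
    rintro ⟨-, -, T', hT', hne, h2, hc⟩
    exact hne (huniq T' hT' (h2.trans h1) hc)
  · rintro ⟨⟨h1, hu⟩, hA, hnot⟩
    refine ⟨hA, h1.symm, hu, fun T' hT' h2 hc => ?_⟩
    by_contra hne
    exact hnot ⟨h1, hu, T', hT', hne, h2.trans h1, hc⟩

/-- **The summand over a present triple is a broken copy of the useful sub-tensor**: `𝒯*_T` with the
`X`- and `Y`-blocks outside the ambient sets (first-type holes) and the `Z`-blocks outside the ambient set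
or compatible with another present triple (first- and second-type holes) zeroed out.
[cite: VassilevskaWilliamsXuXuZhou2024, Claim 5.11 and §6.5 ("there will be two types of holes")] -/
theorem summand_eq_brokenCopy (hS : S.WellFormed) (R : Type u) [CommSemiring R] (q : ℕ) {ω : VxxzSeed M N}
    (T : ↥(S.present ω)) :
    S.summand R q ω T = partSubtensor levelSeq levelSeq levelSeq (S.usefulSub R q T.1) S.AX S.AY (S.AZ \ S.holes ω T.1) := by
  rw [summand, usefulSub, partSubtensor_partSubtensor, assignedParts_assignX, assignedParts_assignY,
    assignedParts_assignZ hS]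

end HashedZeroOut

end Literature.Computability.AlgebraicComplexity
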